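/- Ideator `ym-idea-2` (planner-ym-idea-2-g13-0), route `AllWindowsColdBox`, crux `BoxMidWindowsSU22` (stmt-QuantumFields-24003),
LINE-16: critic idea-crit-4 note N2 (2026-08-29T03:04:18Z) — discharge `stub_midOfDirichletDominationAbs` so that the crux is
«⇐ stub₁ BY KERNEL».  Sorry-free module (HOME ideators/ym-idea-2/l18/AllWindowsColdBoxBoxMidOfDominationAbs.lean, sha16 37a6f825,
critic replay 03:46Z) landed VERBATIM (declarations byte-identical) `--supports stmt-QuantumFields-24003` by width seat
`ym-line-sfw-p2-w3` g34 (cell ym-idea-1, free hands). -/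
import Summits.QuantumFields.YangMills.Theses.AllWindowsColdBox
import Summits.QuantumFields.YangMills.Theorems.ColdBoxAllGroupsBoxFloorAllGroupsExplicit

/-!
# Crux `BoxMidWindowsSU22` (stmt-QuantumFields-24003): the window-agnostic S3∘S4 sandwich

`BoxMidWindowsSU22 := ∀ A θ, 0 < A → A < θ → θ ≤ 7A → θ ≤ 1/16 → ∃ c > 0, BoxTwoPointDomination (SU(2), fundamental) A θ c`.
Its registered skeleton (HOME ideators/ym-idea-2/l17/BoxMidWindowsSU22_birth.lean, sha16 721b2b69) has two stubs: the load-bearing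
ABSOLUTE one-scale comparison `stub_boxDirichletDominationMidAbs` (XL) and the glue `stub_midOfDirichletDominationAbs` (M).
This file proves the glue, in a form that does not know any ceiling:

* `boxTwoPointDomination_of_abs_at` — for EVERY compact `G`, every unitary lattice representation `ρ`, every weight `D ≥ 1`, every
  window `0 < A < θ` and every exponent `κ > 8θ`: if eventually in `β`, for all `T ≤ ⌈β^θ⌉`,
  `|β²·boxPlaqCov ρ β ⌈β^θ⌉ T − (D/4)·boxDirCircSqCov ⌈β^θ⌉ T| ≤ β^{−κ}`, then `BoxTwoPointDomination ρ A θ (c₁²/4)` with `c₁` the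
  kernel-vs-lattice constant of S4 `stub_boxKernelVsLattice` (the body of `ColdBoxAllGroups.boxTwoPointDomination_allGroups_explicit`
  with the absolute comparison as a HYPOTHESIS instead of the ceiling-`1/100` theorem `boxDirichletDominationAbsG_explicit`; the
  reduction `gaussianDomination_of_abs_dim_at` needs only `A < θ`, `8θ < κ`);
* `boxWindow_of_dirichletDominationAbs_ceiling` — hence, at an ARBITRARY ceiling `θc`: the ABSOLUTE comparison of the cold-wall `SU(2)`
  box (weight `3/4 = dimE/4`, exponent `9θ`) for every `0 < θ ≤ θc` gives `∃ c > 0, BoxTwoPointDomination (SU(2), fund) A θ c` for all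
  `0 < A < θ ≤ θc`.  At `θc = 1/16` the hypothesis is literally `stub_boxDirichletDominationMidAbs` and the conclusion is the body of the
  crux `Theses.AllWindowsColdBox.BoxMidWindowsSU22` minus its unused side condition `θ ≤ 7A`;
* `boxMidWindowsSU22_of_dirichletDominationMidAbs` — the crux `Theses.AllWindowsColdBox.BoxMidWindowsSU22` BY NAME from the statement of
  `stub_boxDirichletDominationMidAbs` alone (a CONDITIONAL implication: it credits nothing to the item until stub₁ is proved; the registered
  skeleton v2, HOME ideators/ym-idea-2/l18/BoxMidWindowsSU22_birth_v2.lean, is this composition with stub₁ as its single `sorry`).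

No sorry; no new definition; standard axioms.  NOT the Yang–Mills mass gap and not the crux: finite-volume weak-coupling bookkeeping at
rung level (R2ξ″ RECORD); the analytic content of ⟨24003⟩ is the absolute comparison `stub_boxDirichletDominationMidAbs`, untouched here.
-/

set_option autoImplicit false

noncomputable section

open MeasureTheory
open Literature.MathematicalPhysics.QuantumLattice
open Literature.MathematicalPhysics.QuantumFieldTheory
open Summit.QuantumFields.YangMills.Theorems.WeakCouplingRates
open Summit.QuantumFields.YangMills.Theorems.ColdBoxAllGroups

namespace Summit.QuantumFields.YangMills.Theorems.AllWindowsColdBox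

/-- **Window-agnostic sandwich.**  For every compact `G`, unitary lattice representation `ρ`, weight `D ≥ 1`, window `0 < A < θ`
and exponent `κ > 8θ`: an eventual absolute comparison `|β²·boxPlaqCov ρ β ⌈β^θ⌉ T − (D/4)·boxDirCircSqCov ⌈β^θ⌉ T| ≤ β^{−κ}`
(all `T ≤ ⌈β^θ⌉`) gives `BoxTwoPointDomination ρ A θ (c₁²/4)`.  (Body of `boxTwoPointDomination_allGroups_explicit`, hypothesis
in place of the `θ ≤ 1/100` theorem.)  NOT the Clay mass gap. -/
theorem boxTwoPointDomination_of_abs_at {N : ℕ} {G : Type*} [Group G] [TopologicalSpace G] [IsTopologicalGroup G]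
    [CompactSpace G] [MeasurableSpace G] [BorelSpace G] (ρ : G →* Matrix (Fin N) (Fin N) ℂ) {D A θ κ : ℝ}
    (hD : 1 ≤ D) (hA : 0 < A) (hAθ : A < θ) (hκ : 8 * θ < κ)
    (habs : ∃ β₁ : ℝ, ∀ β : ℝ, β₁ ≤ β → ∀ T : ℕ, T ≤ ⌈β ^ θ⌉₊ →
      |β ^ 2 * boxPlaqCov ρ β ⌈β ^ θ⌉₊ T - D / 4 * boxDirCircSqCov ⌈β ^ θ⌉₊ T| ≤ β ^ (-κ)) :
    ∃ c : ℝ, 0 < c ∧ BoxTwoPointDomination ρ A θ c := by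
  obtain ⟨β₀, h₀⟩ := gaussianDomination_of_abs_dim_at (D := D) (fun β H T => β ^ 2 * boxPlaqCov ρ β H T)
    (by linarith) hA hAθ hκ habs
  obtain ⟨c₁, hc₁, β₁, h₁⟩ := stub_boxKernelVsLattice A θ hA hAθ
  refine ⟨c₁ ^ 2 / 4, by positivity, max β₀ β₁, fun β hβ => ?_⟩
  have h0 := (abs_le.1 (h₀ β (le_trans (le_max_left _ _) hβ))).1
  have h1 := h₁ β (le_trans (le_max_right _ _) hβ)
  have hW := stub_boxGaussianWick ⌈β ^ θ⌉₊ ⌈β ^ A⌉₊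
  set P := boxMaxwellPlaqCov ⌈β ^ θ⌉₊ ⌈β ^ A⌉₊ with hP
  set S := boxCircSqCov ⌈β ^ θ⌉₊ ⌈β ^ A⌉₊ with hS
  have hS2 : S = 2 * P ^ 2 := hW
  have hPsq : 0 ≤ P ^ 2 := sq_nonneg _
  have h1' : (c₁ * |curvaturePlaquetteCorr (d := 4) (by norm_num) (⌈β ^ A⌉₊ : ℤ)|) ^ 2 ≤ |P| ^ 2 :=
    pow_le_pow_left₀ (by positivity) h1 2
  rw [sq_abs, mul_pow, sq_abs] at h1'
  have hmain : (1 / 4 : ℝ) * P ^ 2 ≤ β ^ 2 * boxPlaqCov ρ β ⌈β ^ θ⌉₊ ⌈β ^ A⌉₊ := by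
    have : (D / 4 - 1 / 8) * S ≤ β ^ 2 * boxPlaqCov ρ β ⌈β ^ θ⌉₊ ⌈β ^ A⌉₊ := by
      linarith
    rw [hS2] at this
    nlinarith
  calc c₁ ^ 2 / 4 * curvaturePlaquetteCorr (d := 4) (by norm_num) (⌈β ^ A⌉₊ : ℤ) ^ 2
      = (1 / 4 : ℝ) * (c₁ ^ 2 * curvaturePlaquetteCorr (d := 4) (by norm_num) (⌈β ^ A⌉₊ : ℤ) ^ 2) := by ring
    _ ≤ (1 / 4 : ℝ) * P ^ 2 := by gcongr
    _ ≤ _ := hmain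

/-- **The sandwich at an arbitrary ceiling `θc`, cold-wall `SU(2)` box, fundamental representation (weight `3/4`, exponent `9θ`).**
If for every `0 < θ ≤ θc` the absolute one-scale comparison holds eventually in `β` for all `T ≤ ⌈β^θ⌉`, then for all
`0 < A < θ ≤ θc` some `c > 0` has `BoxTwoPointDomination (fundamentalRep (Fin 2)) A θ c`.  NOT the Clay mass gap. -/
theorem boxWindow_of_dirichletDominationAbs_ceiling (θc : ℝ)
    (h : ∀ θ : ℝ, 0 < θ → θ ≤ θc → ∃ β₀ : ℝ, ∀ β : ℝ, β₀ ≤ β → ∀ T : ℕ, T ≤ ⌈β ^ θ⌉₊ →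
      |β ^ 2 * boxPlaqCov (G := Matrix.specialUnitaryGroup (Fin 2) ℂ) (fundamentalRep (Fin 2)) β ⌈β ^ θ⌉₊ T -
        3 / 4 * boxDirCircSqCov ⌈β ^ θ⌉₊ T| ≤ β ^ (-(9 * θ))) :
    ∀ A θ : ℝ, 0 < A → A < θ → θ ≤ θc → ∃ c : ℝ, 0 < c ∧
      BoxTwoPointDomination (G := Matrix.specialUnitaryGroup (Fin 2) ℂ) (fundamentalRep (Fin 2)) A θ c := by
  intro A θ hA hAθ hθc
  have hθ : 0 < θ := hA.trans hAθ
  exact boxTwoPointDomination_of_abs_at (D := 3) (κ := 9 * θ) (fundamentalRep (Fin 2)) (by norm_num) hA hAθ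
    (by linarith) (h θ hθ hθc)

/-- **Critic N2 — the glue stub of ⟨24003⟩ discharged: `stub_boxDirichletDominationMidAbs ⟹ BoxMidWindowsSU22` BY NAME.**
The hypothesis is literally the statement `BoxDirichletDominationMidAbs` of the registered skeleton (absolute comparison, weight `3/4`,
exponent `9θ`, every `0 < θ ≤ 1/16`); the crux's side condition `θ ≤ 7A` is not used.  NOT the Clay mass gap. -/
theorem boxMidWindowsSU22_of_dirichletDominationMidAbs
    (h : ∀ θ : ℝ, 0 < θ → θ ≤ 1 / 16 → ∃ β₀ : ℝ, ∀ β : ℝ, β₀ ≤ β → ∀ T : ℕ, T ≤ ⌈β ^ θ⌉₊ →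
      |β ^ 2 * boxPlaqCov (G := Matrix.specialUnitaryGroup (Fin 2) ℂ) (fundamentalRep (Fin 2)) β ⌈β ^ θ⌉₊ T -
        3 / 4 * boxDirCircSqCov ⌈β ^ θ⌉₊ T| ≤ β ^ (-(9 * θ))) :
    Summit.QuantumFields.YangMills.Theses.AllWindowsColdBox.BoxMidWindowsSU22 :=
  fun A θ hA hAθ _ hθ => boxWindow_of_dirichletDominationAbs_ceiling (1 / 16) h A θ hA hAθ hθ

end Summit.QuantumFields.YangMills.Theorems.AllWindowsColdBox

end
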